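import Summits.QuantumFields.BalabanUV.T4Continuum.Support.CovariantMeanLatticeDisc
import Literature.MathematicalPhysics.QuantumFieldTheory.Balaban1983to89.MatrixLog

/-!
# `T4Continuum.CovariantMeanChart` (cell-tree module `Summits/QuantumFields/BalabanUV/T4Continuum/Support/CovariantMeanChart.lean`)
# — road P4 of the spine estimate NE1′: leaf L8-DL residue (r2), THE CHART — a configuration whose every bond is within `η ≤ 1/2`
# of `1` (in the algebra norm; for the cell's `SU(2)` carrier this is the interface metric `dist1`) IS a pure-potential
# configuration `exp B` with `‖B_b‖ ≤ 2η`, `B_b = mlog (W b)` the series logarithm of `…Balaban1983to89.MatrixLog`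
# ([Balaban1985Averaging] (21)/(26) pp. 21–22, typed there); hence the lattice depth lemma applies to `W` itself:
# `depth_gain_of_bondSmall`
# (cell `pub-balaban`, sub-cell `t4`, ROUND-2 prover seat #4 of BINDER-OWNERS row NE1′, unit `b2b-balaban-t4-ne1p-p4`, generation 3;
# companion of the skeleton `t4/skeletons/NE1p-t4-ne1p-p4.md` §3 L8-DL residue (r2) / item (f9); ADDITIVE — imports its sibling
# `Support.CovariantMeanLatticeDisc` (p211462) and `…Balaban1983to89.MatrixLog` only; nothing modified)

HONEST FRAMING.  Finite four-torus, rung (B)+1 only.  NOT infinite volume, NOT a mass gap, NOT the Clay problem, NOT summit progress.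
HONEST DEPENDENCY: continuum YM on T⁴ ⇐ BetaPertH ∧ nine spine estimates (0/9 proved); BetaPertH ⇐ (D1) ∧ (D4) ∧ CAP+tail; G-an2-4
gates asym, D1 and NE2/3/4.  Elementary (the series logarithm by name); asserts nothing about T. Bałaban's densities or spaces; every
declaration [folklore] and sorry-free.  WHAT REMAINS of (r2) after this file: only the identification of the cell's `GaugeGroup.dist1`
on the `SU(2)` carrier with `‖· − 1‖` in the `L²`-operator norm (the cell's convention, `Setup` docstring «`dist1 g = |g − 1|` in the
operator norm, B7 (19)»; `T4ExpWindowSmallField` §2), through which `T4AxialGaugeSmallField.dist1_gaugeAct_axialGauge_le_uniform`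
supplies `η = (d−1)·n·δ`.

CITATION HEADER (lean-in-tree rule).  No page of any source is quoted or attributed here; the printed series (21)/(26) are cited in the
imported `MatrixLog`.  Objects re-used BY NAME: `MatrixLog.mlog` / `exp_mlog` / `norm_mlog_le_two_mul`, Mathlib `Ring.inverse_exp`,
`CovariantMeanLatticeDisc.depth_gain_lattice` / `disc` / `discHol` (p211462).
-/

noncomputable section

open NormedSpace Set Metric

namespace Summit.QuantumFields.BalabanUV.T4Continuum.CovariantMeanChart

open Literature.MathematicalPhysics.QuantumFieldTheory.Balaban1983to89 (MatrixLog.mlog MatrixLog.exp_mlog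
  MatrixLog.norm_mlog_le_two_mul)
open CovariantMeanLatticeDisc (disc discHol ContainsSmall depth_gain_lattice)

variable {𝔅 : Type*} [Fintype 𝔅] {𝔸 : Type*} [NormedRing 𝔸] [NormedAlgebra ℂ 𝔸] [CompleteSpace 𝔸]
  {F : Type*} [NormedAddCommGroup F] [NormedSpace ℂ F]

/-! ## §1 The logarithmic chart of a bond-small configuration -/

/-- THE LOGARITHMIC CHART: `logChart W b = mlog (W b)` (the series logarithm about `1`). [folklore] -/
def logChart (W : 𝔅 → 𝔸) : 𝔅 → 𝔸 := fun b => MatrixLog.mlog (W b)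

omit [Fintype 𝔅] in
/-- `exp (logChart W b) = W b` whenever `‖W b − 1‖ < 1`. [folklore] -/
theorem exp_logChart {W : 𝔅 → 𝔸} (hW : ∀ b, ‖W b - 1‖ < 1) (b : 𝔅) : exp (logChart W b) = W b :=
  MatrixLog.exp_mlog (hW b)

omit [Fintype 𝔅] in
/-- The chart's endpoint is the configuration: `disc (logChart W) 1 = W`. [folklore] -/
theorem disc_logChart_one {W : 𝔅 → 𝔸} (hW : ∀ b, ‖W b - 1‖ < 1) : disc (logChart W) 1 = W := by
  funext b
  simp [disc, exp_logChart hW b]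

omit [Fintype 𝔅] in
/-- `‖logChart W b‖ ≤ 2η` whenever `‖W b − 1‖ ≤ η ≤ 1/2`. [folklore] -/
theorem norm_logChart_le {W : 𝔅 → 𝔸} {η : ℝ} (hη : η ≤ 1 / 2) (hW : ∀ b, ‖W b - 1‖ ≤ η) (b : 𝔅) :
    ‖logChart W b‖ ≤ 2 * η :=
  (MatrixLog.norm_mlog_le_two_mul ((hW b).trans hη)).trans (by linarith [hW b])

omit [Fintype 𝔅] in
/-- The plaquette variable of the chart at `ζ = 1` is the configuration's own plaquette variable, the two backward bonds entering
through the ring inverse: `discHol (logChart W) p 1 = W b₁ · W b₂ · (W b₃)⁻¹ʳ · (W b₄)⁻¹ʳ` (Mathlib `Ring.inverse_exp`). [folklore] -/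
theorem discHol_logChart_one {W : 𝔅 → 𝔸} (hW : ∀ b, ‖W b - 1‖ < 1) (p : 𝔅 × 𝔅 × 𝔅 × 𝔅) :
    discHol (logChart W) p 1 =
      W p.1 * W p.2.1 * Ring.inverse (W p.2.2.1) * Ring.inverse (W p.2.2.2) := by
  letI : NormedAlgebra ℚ 𝔸 := NormedAlgebra.restrictScalars ℚ ℂ 𝔸
  simp only [discHol, one_smul]
  rw [← Ring.inverse_exp, ← Ring.inverse_exp, exp_logChart hW, exp_logChart hW, exp_logChart hW, exp_logChart hW]

/-! ## §2 The depth lemma for a bond-small configuration -/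

/-- **THE LATTICE DEPTH GAIN FOR A BOND-SMALL CONFIGURATION** (no potentials given): `Φ` differentiable on an open `S` containing
the small pure-potential configurations, bounded by `N`, `Φ 1 = 0`; a configuration `W` with every bond within `η ≤ 1/2` of `1` and
listed plaquette variables `W b₁ W b₂ (W b₃)⁻¹ʳ (W b₄)⁻¹ʳ` within `δ` of `1`; a radius `Λ > 1` with `8Λη ≤ 1`,
`Λδ + 128Λ²η² < a`, `2Λη < ρ`.  Then `‖Φ W‖ ≤ N/Λ` (`depth_gain_lattice` through the chart `B = logChart W`, `β = 2η`). [folklore] -/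
theorem depth_gain_of_bondSmall {S : Set (𝔅 → 𝔸)} {plaqs : Set (𝔅 × 𝔅 × 𝔅 × 𝔅)} {a ρ N : ℝ} {Φ : (𝔅 → 𝔸) → F}
    (hSo : IsOpen S) (hS : ContainsSmall S plaqs a ρ) (hΦ : DifferentiableOn ℂ Φ S) (hN : ∀ V ∈ S, ‖Φ V‖ ≤ N)
    (h0 : Φ 1 = 0) {W : 𝔅 → 𝔸} {η δ Λ : ℝ} (hη0 : 0 ≤ η) (hη : η ≤ 1 / 2) (hW : ∀ b, ‖W b - 1‖ ≤ η)
    (hδ : ∀ p ∈ plaqs, ‖W p.1 * W p.2.1 * Ring.inverse (W p.2.2.1) * Ring.inverse (W p.2.2.2) - 1‖ ≤ δ)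
    (hΛ : 1 < Λ) (h4 : 8 * Λ * η ≤ 1) (ha : Λ * δ + 128 * Λ ^ 2 * η ^ 2 < a) (hρ : 2 * Λ * η < ρ) :
    ‖Φ W‖ ≤ N / Λ := by
  have hW1 : ∀ b, ‖W b - 1‖ < 1 := fun b => lt_of_le_of_lt ((hW b).trans hη) (by norm_num)
  have hB : ∀ b, ‖logChart W b‖ ≤ 2 * η := norm_logChart_le hη hW
  have hδ' : ∀ p ∈ plaqs, ‖discHol (logChart W) p 1 - 1‖ ≤ δ := by
    intro p hp
    rw [discHol_logChart_one hW1 p]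
    exact hδ p hp
  have h4' : 4 * Λ * (2 * η) ≤ 1 := by linarith
  have ha' : Λ * δ + 32 * Λ ^ 2 * (2 * η) ^ 2 < a := by nlinarith
  have hρ' : Λ * (2 * η) < ρ := by linarith
  have h := depth_gain_lattice hSo hS hΦ hN h0 (by linarith) hB hδ' hΛ h4' ha' hρ'
  have e : (fun b => exp (logChart W b)) = W := funext (exp_logChart hW1)
  rwa [e] at h

/-- **DEEP REGIME FOR A BOND-SMALL CONFIGURATION, road letters**: with the configuration at relative depth `θ` (`δ ≤ θ·a`,
`0 < θ < 1/2`, `0 < a ≤ 1`), bonds within `η ≤ K·δ` of `1` (the axial-gauge letter `K`; `η ≤ 1/2`), `64K²a < 1` and `K·a < ρ`: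
`‖Φ W‖ ≤ 2θ·N` (`Λ = 1/(2θ)`). [folklore] -/
theorem depth_gain_of_bondSmall_deep {S : Set (𝔅 → 𝔸)} {plaqs : Set (𝔅 × 𝔅 × 𝔅 × 𝔅)} {a ρ N : ℝ}
    {Φ : (𝔅 → 𝔸) → F} (hSo : IsOpen S) (hS : ContainsSmall S plaqs a ρ) (hΦ : DifferentiableOn ℂ Φ S)
    (hN : ∀ V ∈ S, ‖Φ V‖ ≤ N) (h0 : Φ 1 = 0) {W : 𝔅 → 𝔸} {η δ θ K : ℝ} (hη0 : 0 ≤ η) (hη : η ≤ 1 / 2)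
    (hW : ∀ b, ‖W b - 1‖ ≤ η)
    (hδ : ∀ p ∈ plaqs, ‖W p.1 * W p.2.1 * Ring.inverse (W p.2.2.1) * Ring.inverse (W p.2.2.2) - 1‖ ≤ δ)
    (hθ0 : 0 < θ) (hθ : θ < 1 / 2) (ha0 : 0 < a) (ha1 : a ≤ 1) (hδθ : δ ≤ θ * a) (hK : 0 ≤ K)
    (hηK : η ≤ K * δ) (hN2 : 64 * K ^ 2 * a < 1) (hsupp : K * a < ρ) : ‖Φ W‖ ≤ 2 * θ * N := by
  set Λ : ℝ := 1 / (2 * θ) with hΛ_def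
  have hΛθ : Λ * θ = 1 / 2 := by rw [hΛ_def]; field_simp
  have hΛ1 : 1 < Λ := by rw [hΛ_def, lt_div_iff₀ (by positivity)]; linarith
  have hΛ0 : 0 < Λ := zero_lt_one.trans hΛ1
  -- `η ≤ K θ a`
  have hη' : η ≤ K * (θ * a) := hηK.trans (mul_le_mul_of_nonneg_left hδθ hK)
  -- `Λ η ≤ K a / 2`
  have hΛη : Λ * η ≤ K * a / 2 := by
    calc Λ * η ≤ Λ * (K * (θ * a)) := mul_le_mul_of_nonneg_left hη' hΛ0.le
      _ = (Λ * θ) * (K * a) := by ring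
      _ = K * a / 2 := by rw [hΛθ]; ring
  have hKa : K * a < 1 / 8 := by nlinarith
  have h4 : 8 * Λ * η ≤ 1 := by nlinarith
  have ha : Λ * δ + 128 * Λ ^ 2 * η ^ 2 < a := by
    have e1 : Λ * δ ≤ a / 2 := by
      calc Λ * δ ≤ Λ * (θ * a) := mul_le_mul_of_nonneg_left hδθ hΛ0.le
        _ = (Λ * θ) * a := by ring
        _ = a / 2 := by rw [hΛθ]; ring
    have e2 : 128 * Λ ^ 2 * η ^ 2 ≤ 32 * (K * a) ^ 2 := by
      have := pow_le_pow_left₀ (by positivity) hΛη 2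
      nlinarith
    have e3 : 32 * (K * a) ^ 2 < a / 2 := by
      have : (K * a) ^ 2 = (K ^ 2 * a) * a := by ring
      rw [this]; nlinarith
    linarith
  have hρ : 2 * Λ * η < ρ := by nlinarith
  have h := depth_gain_of_bondSmall hSo hS hΦ hN h0 hη0 hη hW hδ hΛ1 h4 ha hρ
  calc ‖Φ W‖ ≤ N / Λ := h
    _ = 2 * θ * N := by rw [hΛ_def]; field_simp

end Summit.QuantumFields.BalabanUV.T4Continuum.CovariantMeanChart

end
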